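import Literature.Probability.LatticeModels.HighDimTrivialityUniformProofs
import Literature.Probability.LatticeModels.PlusFreeComparison
import HarnessLib

/-!
# High-dimensional triviality of Ising scaling limits, V: crit-ising.S13 for arbitrary temperatures

Trunk: StatMech (G02); family `crit-ising` (crit-ising.S13). Top of the stack
`HighDimTriviality` → `HighDimTrivialityMoments` → `HighDimTrivialityWick` /
`HighDimTrivialityUniform(Proofs)`.

This file proves the statement **`isGaussianProcess_of_tendstoInDistribution_smearedSpin` of
`Sweep1` in its original form** — every subsequential limit in law of the rescaled spin field
`Φ_k(f) = ρ_k δ_k^d ∑_x f(δ_k x) σ_x` of the nearest-neighbour Ising model on `ℤ^d`, `d ≥ 4`,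
along *arbitrary* temperatures `β_k ∈ [0, β_c]`, meshes `δ_k → 0⁺` and renormalisations
`ρ_k > 0` with bounded second moments, is a Gaussian generalised random field — from named
facts of the literature (`isGaussianProcess_of_tendstoInDistribution_smearedSpin_of_facts`):

* the smeared Aizenman inequality `aizenman_evenMoment_deviation_le` and Gaussian domination
  `newman_evenMoment_le` (Aizenman 1982; ADC 2021 §6.3; Panis 2023 Prop. 4.6 — reduced to the
  pointwise / finite-volume inequality for correlation functions in `HighDimTrivialityWick`);
* Aizenman's tree diagram bound `aizenman_treeDiagramBound` (1982);
* Panis 2023, Cor. 1.8 (`panis_ursellFourSum_le_four`, `d = 4`, sharp-length window) and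
  Thm 5.5 (`panis_ursellFourSum_le`, `d ≥ 5`);
* the structure of `𝒢(β, 0)` up to `β_c`: uniqueness (`hasUniqueGibbsMeasure_of_lt_criticalBeta`,
  `hasUniqueGibbsMeasure_criticalBeta`) and the free state (`exists_freeMeasure`); the finite-volume
  flip symmetry `isingCorr_free_of_odd_card` is a theorem of the tree
  (`isingCorr_free_of_odd_card_holds`, `PlusFreeComparison`) and is fed in.

Thus the `Sweep1` statement, recorded in `HighDimTriviality` as more general than each of the
printed theorems (which cover the windows `L ≤ ξ(β)` / `L ≤ L(β)`, or `d ≥ 5` with constants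
blowing up as `β → 0`, or fixed `β < β_c`), is a consequence of the printed results: the missing
uniformity in `β` is the uniform smallness of `S(μ; L, r) = Σ_L⁻² ∑_{x ∈ Λ_{rL}⁴} |U₄^μ(x)|`
(`sup {S(μ; L, r) : β ∈ [0, β_c], μ ∈ 𝒢(β, 0)} → 0` as `L → ∞`, `d ≥ 4`), which enters the
theorems below as the explicit hypothesis `hU` and is PROVED from the named facts in
`HighDimTrivialityUniformProofs` (`ursellFourSum_uniformlySmall_of_facts`; it is a derived
statement, printed by no source, and deliberately carries no name of its own).

## The argument

For one test function `g` (`tendsto_mgf_mul_exp_sub_one_uniform`): with `L_k = 1/δ_k` and the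
renormalisation `Φ_k(g) = a_k T_{g,L_k}`, `a_k² ≤ C₀/c₀` (bounded second moments and the lower
variance bound for one bump `f₀`, as in `HighDimTrivialityMoments`, Part E), the summed moment
bounds (`abs_mgf_normalizedField_sub_exp_le`: Aizenman's inequality, Gaussian domination, flip
symmetry) give
`|M_k(z) - e^{z² V_k/2}| ≤ e^{z² A Cabs/2} · 24 ‖g‖_∞⁴ A² z⁴ · S(μ_k; L_k, r)`,
and `S(μ_k; L_k, r) → 0` by uniform smallness, whatever the temperatures `β_k ∈ [0, β_c]`.
The rest (uniform exponential integrability, convergence of exponential moments along the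
convergence in law, identification of the limit law as `N(0, v)` through `complexMGF`, and
linearity) is the argument of `HighDimTriviality`, Part II, verbatim.

## Mathlib

`MeasureTheory.TendstoInDistribution`, `ProbabilityTheory.IsGaussianProcess`,
`ProbabilityTheory.isGaussian_of_map_eq_gaussianReal`, `gaussianReal`; no new definitions.
-/

noncomputable section

open MeasureTheory ProbabilityTheory Filter Topology TopologicalSpace
open scoped NNReal
open Literature.Probability.LatticeModels Literature.Probability.Percolation

namespace Literature.Probability.LatticeModels

variable {d : ℕ}

/-- Uniform smallness along a sequence: if `δ_k → 0⁺` then `S(μ_k; 1/δ_k, r) → 0` for any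
states `μ_k ∈ 𝒢(β_k, 0)`, `β_k ∈ [0, β_c]`, granting the uniform smallness of `S(μ; L, r)`
(hypothesis `hU`: for `d ≥ 4`, `r ≥ 1`, `ε > 0` there is `L₀` with `S(μ; L, r) ≤ ε` for all
`L ≥ L₀`, `β ∈ [0, β_c]`, `μ ∈ 𝒢(β, 0)`; it is the conclusion of
`ursellFourSum_uniformlySmall_of_facts` of `HighDimTrivialityUniformProofs`). [folklore] -/
theorem tendsto_ursellFourSum_of_uniformlySmall
    (hU : ∀ {d : ℕ}, 4 ≤ d → ∀ r : ℝ, 1 ≤ r → ∀ ε : ℝ, 0 < ε → ∃ L₀ : ℝ,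
      ∀ (β L : ℝ), 0 ≤ β → β ≤ criticalBeta d → L₀ ≤ L →
      ∀ μ ∈ isingGibbsMeasures d β 0, ursellFourSum μ L r ≤ ε) (hd : 4 ≤ d)
    {β δ : ℕ → ℝ} (hβ : ∀ k, β k ∈ Set.Icc 0 (criticalBeta d))
    (hδ : Tendsto δ atTop (𝓝[>] (0 : ℝ)))
    {μ : ℕ → Measure (SpinConfig (Site d))} (hμ : ∀ k, μ k ∈ isingGibbsMeasures d (β k) 0)
    {r : ℝ} (hr : 1 ≤ r) :
    Tendsto (fun k => ursellFourSum (μ k) (δ k)⁻¹ r) atTop (𝓝 0) := by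
  have hLtop : Tendsto (fun k => (δ k)⁻¹) atTop atTop := tendsto_inv_nhdsGT_zero.comp hδ
  rw [Metric.tendsto_atTop]
  intro ε hε
  obtain ⟨L₀, hL₀⟩ := hU hd r hr (ε / 2) (half_pos hε)
  obtain ⟨N, hN⟩ := eventually_atTop.1 (hLtop.eventually (eventually_ge_atTop L₀))
  refine ⟨N, fun k hk => ?_⟩
  rw [Real.dist_eq, sub_zero, abs_of_nonneg (ursellFourSum_nonneg _ _ _)]
  exact (hL₀ (β k) (δ k)⁻¹ (hβ k).1 (hβ k).2 (hN k hk) (μ k) (hμ k)).trans_lt (half_lt_self hε)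

/-- **Core estimate (one test function) along one sequence, from an eventual exponential-moment
bound.** Let `β_k ∈ [0, β_c]`, `δ_k → 0⁺`, `μ_k ∈ 𝒢(β_k, 0)` (plain measures), and suppose that for
every radius `r ≥ 1` there is `ε_k → 0` (`ε_k ≥ 0`) with
`|⟨e^{zT_{f,L_k}}⟩_{μ_k} - e^{z²⟨T_{f,L_k}²⟩/2}| ≤ e^{z²⟨T_{|f|,L_k}²⟩/2} · ‖f‖_∞⁴ ε_k z⁴` (`L_k = 1/δ_k`)
for all `f ∈ C_0` vanishing outside `[-r,r]^d` and real `z` — the shape of the third display of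
Aizenman–Duminil-Copin 2021, §6.3 (p. 26) / Aizenman CDM 2020 (7.9) / Panis 2023, Thm 5.5, with the
smallness factor (`C₁ S(β,L,f)`, resp. `C (β⁻⁴∨β⁻²) r^γ L^{4-d}`, resp. `C r^γ (log L)^{-c}`)
abstracted into `ε_k`. Then, granting the variance bounds, for every `g ∈ C_c` and real `z`,
`M_k(z) e^{-z² E[Φ_k(g)²]/2} - 1 → 0` for `Φ_k(g) = ρ_k δ_k^d ∑ g(δ_k x) σ_x` with bounded second
moments of one bump `f₀` (renormalisation `Φ_k = a_k T_{·,L_k}`, `a_k² ≤ C₀/c₀`; the prefactor is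
bounded through the upper variance bound for `|g|`). [cite: AizenmanDuminilCopinAnnals2021, arXiv:1912.07973 §6.3 third display (p. 26) and p. 6 (the Gaussianity argument)] [cite: AizenmanCDM2020, §7 eq. (7.9)] -/
theorem tendsto_mgf_mul_exp_sub_one_of_seqBound
    (h₂ : normalizedField_variance_bounds)
    (hd : 4 ≤ d) {β δ ρ : ℕ → ℝ} (hβ : ∀ k, β k ∈ Set.Icc 0 (criticalBeta d))
    (hδ : Tendsto δ atTop (𝓝[>] (0 : ℝ)))
    {μ : ℕ → Measure (SpinConfig (Site d))}
    (hμ : ∀ k, μ k ∈ isingGibbsMeasures d (β k) 0)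
    {g : EuclideanSpace ℝ (Fin d) → ℝ} (hg : Continuous g) (hgs : HasCompactSupport g)
    {f₀ : EuclideanSpace ℝ (Fin d) → ℝ} (hf₀ : Continuous f₀) (hf₀s : HasCompactSupport f₀)
    (hf₀0 : ∀ x, 0 ≤ f₀ x) (hf₀ne : f₀ ≠ 0)
    {C₀ : ℝ} (hC₀ : ∀ k, ∫ σ, smearedSpin (ρ k) (δ k) f₀ σ ^ 2 ∂μ k ≤ C₀)
    (hmgf : ∀ r : ℝ, 1 ≤ r → ∃ ε : ℕ → ℝ, (∀ k, 0 ≤ ε k) ∧ Tendsto ε atTop (𝓝 0) ∧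
      ∀ k, 0 < δ k → ∀ {f : EuclideanSpace ℝ (Fin d) → ℝ}, Continuous f →
        (∀ x, f x ≠ 0 → ∀ i, |x i| ≤ r) → ∀ z : ℝ,
        |(∫ σ, Real.exp (z * normalizedField (μ k) (δ k)⁻¹ f σ) ∂μ k) -
            Real.exp (z ^ 2 / 2 * ∫ σ, normalizedField (μ k) (δ k)⁻¹ f σ ^ 2 ∂μ k)|
          ≤ Real.exp (z ^ 2 / 2 * ∫ σ, normalizedField (μ k) (δ k)⁻¹ (fun x => |f x|) σ ^ 2 ∂μ k) *
              ((⨆ x, |f x|) ^ 4 * ε k * z ^ 4)) (z : ℝ) :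
    Tendsto (fun k =>
      (∫ σ, Real.exp (z * smearedSpin (ρ k) (δ k) g σ) ∂μ k) *
          Real.exp (-(z ^ 2 * (∫ σ, smearedSpin (ρ k) (δ k) g σ ^ 2 ∂μ k) / 2)) - 1)
      atTop (𝓝 0) := by
  -- meshes: `δ_k > 0` eventually and `L_k = 1/δ_k → ∞`
  have hδpos : ∀ᶠ k in atTop, 0 < δ k := hδ.eventually (eventually_mem_nhdsWithin)
  have hLtop : Tendsto (fun k => (δ k)⁻¹) atTop atTop := tendsto_inv_nhdsGT_zero.comp hδ
  obtain ⟨r, hr1, hgr⟩ := exists_cube_of_hasCompactSupport g hgs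
  -- variance bounds: upper for `|g|`, lower for the bump `f₀`
  obtain ⟨Cabs, hCabs⟩ := (h₂ hd (fun x => |g x|) hg.abs (hgs.comp_left abs_zero)).1
  obtain ⟨c₀, L₀, hc₀, hlow⟩ := (h₂ hd f₀ hf₀ hf₀s).2 hf₀0 hf₀ne
  set A2 : ℝ := C₀ / c₀ with hA2
  have hA2nn : 0 ≤ A2 :=
    div_nonneg ((integral_nonneg fun σ => sq_nonneg _).trans (hC₀ 0)) hc₀.le
  have hev : ∀ᶠ k in atTop, 0 < δ k ∧ 1 < (δ k)⁻¹ ∧ L₀ ≤ (δ k)⁻¹ :=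
    (hδpos.and (hLtop.eventually (eventually_gt_atTop 1))).and
      (hLtop.eventually (eventually_ge_atTop L₀)) |>.mono fun k hk => ⟨hk.1.1, hk.1.2, hk.2⟩
  -- per-`k` renormalisation: `Φ_k(f) = a_k T_{f,L_k}` with `a_k² ≤ A2`
  have hren : ∀ k, 0 < δ k → L₀ ≤ (δ k)⁻¹ →
      ∃ a : ℝ, a ^ 2 ≤ A2 ∧ ∀ (f : EuclideanSpace ℝ (Fin d) → ℝ) (σ : SpinConfig (Site d)),
        smearedSpin (ρ k) (δ k) f σ = a * normalizedField (μ k) (δ k)⁻¹ f σ := by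
    intro k hδk hLL₀
    have hlowk := hlow (β k) (δ k)⁻¹ (hβ k).1 (hβ k).2 hLL₀ (μ k) (hμ k)
    have hS0 : Real.sqrt (blockSpinVariance (μ k) (δ k)⁻¹) ≠ 0 := by
      intro hS0
      have h0 : ∀ σ, normalizedField (μ k) (δ k)⁻¹ f₀ σ = 0 := fun σ => by
        rw [normalizedField, hS0, inv_zero, zero_mul]
      have : ∫ σ, normalizedField (μ k) (δ k)⁻¹ f₀ σ ^ 2 ∂μ k = 0 := by simp [h0]
      linarith
    refine ⟨ρ k * δ k ^ d * Real.sqrt (blockSpinVariance (μ k) (δ k)⁻¹), ?_,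
      fun f σ => smearedSpin_eq_mul_normalizedField (μ k) hS0 f σ⟩
    set a := ρ k * δ k ^ d * Real.sqrt (blockSpinVariance (μ k) (δ k)⁻¹) with ha
    have h1 : a ^ 2 * ∫ σ, normalizedField (μ k) (δ k)⁻¹ f₀ σ ^ 2 ∂μ k ≤ C₀ := by
      have h := hC₀ k
      have heq : ∀ σ, smearedSpin (ρ k) (δ k) f₀ σ ^ 2 =
          a ^ 2 * normalizedField (μ k) (δ k)⁻¹ f₀ σ ^ 2 := fun σ => by
        rw [smearedSpin_eq_mul_normalizedField (μ k) hS0 f₀ σ, mul_pow]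
      simp_rw [heq, integral_const_mul] at h
      exact h
    rw [hA2, le_div_iff₀ hc₀]
    calc a ^ 2 * c₀ ≤ a ^ 2 * ∫ σ, normalizedField (μ k) (δ k)⁻¹ f₀ σ ^ 2 ∂μ k :=
        mul_le_mul_of_nonneg_left hlowk (sq_nonneg a)
      _ ≤ C₀ := h1
  -- the smallness sequence `ε_k → 0` of the exponential-moment bound at radius `r`
  obtain ⟨ε, hε0, hε, hbound⟩ := hmgf r hr1
  refine squeeze_zero_norm' (a := fun k =>
    (Real.exp (z ^ 2 / 2 * (A2 * Cabs)) * ((⨆ x, |g x|) ^ 4 * (A2 ^ 2 * z ^ 4))) * ε k)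
    (hev.mono fun k hk => ?_) (by simpa using tendsto_const_nhds.mul hε)
  obtain ⟨hδk, hL1, hLL₀⟩ := hk
  obtain ⟨a, ha2, hX⟩ := hren k hδk hLL₀
  haveI : IsProbabilityMeasure (μ k) := (hμ k).1
  have hest := hbound k hδk hg hgr (a * z)
  have hV : (∫ σ, smearedSpin (ρ k) (δ k) g σ ^ 2 ∂μ k) =
      a ^ 2 * ∫ σ, normalizedField (μ k) (δ k)⁻¹ g σ ^ 2 ∂μ k := by
    have heq : ∀ σ, smearedSpin (ρ k) (δ k) g σ ^ 2 =
        a ^ 2 * normalizedField (μ k) (δ k)⁻¹ g σ ^ 2 := fun σ => by rw [hX g σ, mul_pow]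
    simp_rw [heq, integral_const_mul]
  have hM : (∫ σ, Real.exp (z * smearedSpin (ρ k) (δ k) g σ) ∂μ k) =
      ∫ σ, Real.exp (a * z * normalizedField (μ k) (δ k)⁻¹ g σ) ∂μ k := by
    refine integral_congr_ae (Eventually.of_forall fun σ => ?_)
    dsimp only
    rw [hX g σ]
    ring_nf
  set s : ℝ := (a * z) ^ 2 / 2 * ∫ σ, normalizedField (μ k) (δ k)⁻¹ g σ ^ 2 ∂μ k with hs_def
  have hs : z ^ 2 * (∫ σ, smearedSpin (ρ k) (δ k) g σ ^ 2 ∂μ k) / 2 = s := by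
    rw [hs_def, hV]
    ring
  have hs0 : 0 ≤ s := mul_nonneg (by positivity) (integral_nonneg fun σ => sq_nonneg _)
  -- the prefactor `exp((az)²/2 ⟨T_{|g|}²⟩)` is bounded via the upper variance bound
  have hW : (a * z) ^ 2 / 2 * ∫ σ, normalizedField (μ k) (δ k)⁻¹ (fun x => |g x|) σ ^ 2 ∂μ k
      ≤ z ^ 2 / 2 * (A2 * Cabs) := by
    have hIle := hCabs (β k) (δ k)⁻¹ (hβ k).1 (hβ k).2 hL1.le (μ k) (hμ k)
    have hI0 : 0 ≤ ∫ σ, normalizedField (μ k) (δ k)⁻¹ (fun x => |g x|) σ ^ 2 ∂μ k :=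
      integral_nonneg fun σ => sq_nonneg _
    calc (a * z) ^ 2 / 2 * ∫ σ, normalizedField (μ k) (δ k)⁻¹ (fun x => |g x|) σ ^ 2 ∂μ k
        = z ^ 2 / 2 * (a ^ 2 *
            ∫ σ, normalizedField (μ k) (δ k)⁻¹ (fun x => |g x|) σ ^ 2 ∂μ k) := by ring
      _ ≤ z ^ 2 / 2 * (A2 * Cabs) := by gcongr
  -- `|M e^{-s} - 1| = e^{-s} |M - e^{s}| ≤ |M - e^{s}|`
  have hkey : ∀ M : ℝ, |M * Real.exp (-s) - 1| ≤ |M - Real.exp s| := by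
    intro M
    have h1 : M * Real.exp (-s) - 1 = Real.exp (-s) * (M - Real.exp s) := by
      rw [mul_sub, Real.exp_neg, ← mul_comm M, inv_mul_cancel₀ (Real.exp_pos s).ne']
    rw [h1, abs_mul, Real.abs_exp]
    exact mul_le_of_le_one_left (abs_nonneg _) (Real.exp_le_one_iff.mpr (neg_nonpos.mpr hs0))
  rw [Real.norm_eq_abs, hs, hM]
  refine (hkey _).trans ?_
  have hU0 : 0 ≤ ε k := hε0 k
  calc |(∫ σ, Real.exp (a * z * normalizedField (μ k) (δ k)⁻¹ g σ) ∂μ k) - Real.exp s|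
      ≤ Real.exp ((a * z) ^ 2 / 2 *
            ∫ σ, normalizedField (μ k) (δ k)⁻¹ (fun x => |g x|) σ ^ 2 ∂μ k) *
          ((⨆ x, |g x|) ^ 4 * ε k * (a * z) ^ 4) := hest
    _ ≤ Real.exp (z ^ 2 / 2 * (A2 * Cabs)) *
          ((⨆ x, |g x|) ^ 4 * ε k * (A2 ^ 2 * z ^ 4)) := by
        have h0 : 0 ≤ (⨆ x, |g x|) ^ 4 := pow_nonneg (iSup_abs_nonneg g) 4
        gcongr
        calc (a * z) ^ 4 = (a ^ 2) ^ 2 * z ^ 4 := by ring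
          _ ≤ A2 ^ 2 * z ^ 4 := by gcongr
    _ = (Real.exp (z ^ 2 / 2 * (A2 * Cabs)) * ((⨆ x, |g x|) ^ 4 * (A2 ^ 2 * z ^ 4))) * ε k := by
        ring

/-- **Core estimate (one test function), uniformly in the temperature, from a one-state
exponential-moment bound.** As `tendsto_mgf_mul_exp_sub_one_uniform`, but with the summed moment
bound `|⟨e^{zT_{f,L}}⟩_μ - e^{z²⟨T_{f,L}²⟩/2}| ≤ e^{z²⟨T_{|f|,L}²⟩/2} · 24 ‖f‖_∞⁴ S(μ;L,r) z⁴` for the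
states `μ ∈ 𝒢(β,0)`, `β ≤ β_c` (the third display of Aizenman–Duminil-Copin 2021, §6.3, p. 26 /
Aizenman CDM 2020 (7.9)) taken as an explicit hypothesis `hmgf`, so that it can be fed either by
`abs_mgf_normalizedField_sub_exp_le` (the ADC-quoted moment facts) or by the source form of
Aizenman's Prop. 12.1 (`AizenmanWickBound.abs_mgf_normalizedField_sub_exp_le_of_wickBounds`). With
`L_k = 1/δ_k`, the renormalisation `Φ_k(g) = a_k T_{g,L_k}`, `a_k² ≤ C₀/c₀`, and uniform smallness
of `S(μ_k; L_k, r)`, it gives `M_k(z) e^{-z² E[Φ_k(g)²]/2} - 1 → 0`. [cite: AizenmanDuminilCopinAnnals2021, arXiv:1912.07973 §6.3 third display (p. 26) and p. 6 (the Gaussianity argument)] [cite: AizenmanCDM2020, §7 eq. (7.9)] -/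
theorem tendsto_mgf_mul_exp_sub_one_of_mgfBound
    (hmgf : ∀ {β L r : ℝ}, 0 ≤ β → β ≤ criticalBeta d → 0 < L → 1 ≤ r →
      ∀ {μ : Measure (SpinConfig (Site d))}, μ ∈ isingGibbsMeasures d β 0 →
      ∀ {f : EuclideanSpace ℝ (Fin d) → ℝ}, Continuous f → (∀ x, f x ≠ 0 → ∀ i, |x i| ≤ r) →
      ∀ z : ℝ,
        |(∫ σ, Real.exp (z * normalizedField μ L f σ) ∂μ) -
            Real.exp (z ^ 2 / 2 * ∫ σ, normalizedField μ L f σ ^ 2 ∂μ)|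
          ≤ Real.exp (z ^ 2 / 2 * ∫ σ, normalizedField μ L (fun x => |f x|) σ ^ 2 ∂μ) *
              (24 * (⨆ x, |f x|) ^ 4 * ursellFourSum μ L r * z ^ 4))
    (h₂ : normalizedField_variance_bounds)
    (hU : ∀ {d : ℕ}, 4 ≤ d → ∀ r : ℝ, 1 ≤ r → ∀ ε : ℝ, 0 < ε → ∃ L₀ : ℝ,
      ∀ (β L : ℝ), 0 ≤ β → β ≤ criticalBeta d → L₀ ≤ L →
      ∀ μ ∈ isingGibbsMeasures d β 0, ursellFourSum μ L r ≤ ε)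
    (hd : 4 ≤ d) {β δ ρ : ℕ → ℝ} (hβ : ∀ k, β k ∈ Set.Icc 0 (criticalBeta d))
    (hδ : Tendsto δ atTop (𝓝[>] (0 : ℝ)))
    {μ : ℕ → Measure (SpinConfig (Site d))}
    (hμ : ∀ k, μ k ∈ isingGibbsMeasures d (β k) 0)
    {g : EuclideanSpace ℝ (Fin d) → ℝ} (hg : Continuous g) (hgs : HasCompactSupport g)
    {f₀ : EuclideanSpace ℝ (Fin d) → ℝ} (hf₀ : Continuous f₀) (hf₀s : HasCompactSupport f₀)
    (hf₀0 : ∀ x, 0 ≤ f₀ x) (hf₀ne : f₀ ≠ 0)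
    {C₀ : ℝ} (hC₀ : ∀ k, ∫ σ, smearedSpin (ρ k) (δ k) f₀ σ ^ 2 ∂μ k ≤ C₀) (z : ℝ) :
    Tendsto (fun k =>
      (∫ σ, Real.exp (z * smearedSpin (ρ k) (δ k) g σ) ∂μ k) *
          Real.exp (-(z ^ 2 * (∫ σ, smearedSpin (ρ k) (δ k) g σ ^ 2 ∂μ k) / 2)) - 1)
      atTop (𝓝 0) :=
  tendsto_mgf_mul_exp_sub_one_of_seqBound h₂ hd hβ hδ hμ hg hgs hf₀ hf₀s hf₀0 hf₀ne hC₀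
    (fun r hr => ⟨fun k => 24 * ursellFourSum (μ k) (δ k)⁻¹ r,
      fun k => mul_nonneg (by norm_num) (ursellFourSum_nonneg _ _ _),
      by simpa using (tendsto_ursellFourSum_of_uniformlySmall hU hd hβ hδ hμ hr).const_mul 24,
      fun k hδk {_} hf hfr z' =>
        (hmgf (hβ k).1 (hβ k).2 (inv_pos.2 hδk) hr (hμ k) hf hfr z').trans_eq (by ring)⟩) z

/-- **Core estimate (one test function), uniformly in the temperature.** In the setting of
`isGaussianProcess_of_tendstoInDistribution_smearedSpin` (arbitrary `β_k ∈ [0, β_c]`, `δ_k → 0⁺`),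
with `μ_k` plain measures: the summed moment bounds (Aizenman's inequality, Gaussian domination,
flip symmetry: `abs_mgf_normalizedField_sub_exp_le`) and the uniform smallness of
`S(μ; L, r)` give `M_k(z) exp(-z² E[Φ_k(g)²]/2) - 1 → 0` for the exponential moments
`M_k(z) = E[exp(z Φ_k(g))]`, `z ∈ ℝ`, provided the second moments of `Φ_k(f₀)` for one
nonnegative `f₀ ≢ 0` are bounded (renormalisation step of `HighDimTrivialityMoments`, Part E; the
second moments of `Φ_k(g)` itself are then controlled by the upper variance bound for `|g|`). [cite: Panis2023Triviality, Thm. 1.2/1.3 and Cor. 1.8 ("every sub-sequential scaling limit is Gaussian"), §1.2.1 fn. 2] -/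
theorem tendsto_mgf_mul_exp_sub_one_uniform
    (hM1 : aizenman_evenMoment_deviation_le) (hM2 : newman_evenMoment_le)
    (hodd : oddSpinCorrelation_eq_zero) (h₂ : normalizedField_variance_bounds)
    (hU : ∀ {d : ℕ}, 4 ≤ d → ∀ r : ℝ, 1 ≤ r → ∀ ε : ℝ, 0 < ε → ∃ L₀ : ℝ,
      ∀ (β L : ℝ), 0 ≤ β → β ≤ criticalBeta d → L₀ ≤ L →
      ∀ μ ∈ isingGibbsMeasures d β 0, ursellFourSum μ L r ≤ ε)
    (hd : 4 ≤ d) {β δ ρ : ℕ → ℝ} (hβ : ∀ k, β k ∈ Set.Icc 0 (criticalBeta d))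
    (hδ : Tendsto δ atTop (𝓝[>] (0 : ℝ)))
    {μ : ℕ → Measure (SpinConfig (Site d))}
    (hμ : ∀ k, μ k ∈ isingGibbsMeasures d (β k) 0)
    {g : EuclideanSpace ℝ (Fin d) → ℝ} (hg : Continuous g) (hgs : HasCompactSupport g)
    {f₀ : EuclideanSpace ℝ (Fin d) → ℝ} (hf₀ : Continuous f₀) (hf₀s : HasCompactSupport f₀)
    (hf₀0 : ∀ x, 0 ≤ f₀ x) (hf₀ne : f₀ ≠ 0)
    {C₀ : ℝ} (hC₀ : ∀ k, ∫ σ, smearedSpin (ρ k) (δ k) f₀ σ ^ 2 ∂μ k ≤ C₀) (z : ℝ) :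
    Tendsto (fun k =>
      (∫ σ, Real.exp (z * smearedSpin (ρ k) (δ k) g σ) ∂μ k) *
          Real.exp (-(z ^ 2 * (∫ σ, smearedSpin (ρ k) (δ k) g σ ^ 2 ∂μ k) / 2)) - 1)
      atTop (𝓝 0) :=
  tendsto_mgf_mul_exp_sub_one_of_mgfBound
    (fun {_ _ _} hβ' hβc hL hr {_} hμ' {_} hf hfr z' =>
      abs_mgf_normalizedField_sub_exp_le hM1 hM2 hodd (by omega) hβ' hβc hL hr hμ' hf hfr z')
    h₂ hU hd hβ hδ hμ hg hgs hf₀ hf₀s hf₀0 hf₀ne hC₀ z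

universe u in
/-- **Gaussianity of the limit along one sequence, from an eventual exponential-moment bound**
(the probabilistic half of Aizenman–Duminil-Copin 2021, Thm 1.2 / p. 6 and Panis 2023, Thm 1.2 /
Cor. 1.8 "every sub-sequential scaling limit is Gaussian", with the analytic input abstracted):
for `d ≥ 4`, `β_k ∈ [0, β_c]`, `δ_k → 0⁺`, `μ_k ∈ 𝒢(β_k, 0)`, if the rescaled fields `Φ_k(f)` have
bounded second moments and converge in law for every test function to `Φ(f)`, `Φ` a linear random
functional, and the exponential moments of the normalised fields `T_{f,1/δ_k}` under `μ_k` obey the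
bound of `tendsto_mgf_mul_exp_sub_one_of_seqBound` with `ε_k → 0` for every radius, then `Φ` is a
Gaussian process (granting the variance bounds). Steps: every one-dimensional marginal is a
centred Gaussian (uniform exponential integrability, convergence of exponential moments along the
convergence in law, `exists_variance_of_tendsto_mgf`, `eq_gaussianReal_of_mgf_eq`), and linearity of
`Φ` upgrades this to all finite-dimensional marginals. [cite: AizenmanDuminilCopinAnnals2021, arXiv:1912.07973 Thm 1.2 and p. 6 (the Gaussianity argument)] [cite: Panis2023Triviality, Thm. 1.2 and Cor. 1.8 (sub-sequential scaling limits are Gaussian)] -/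
theorem isGaussianProcess_of_tendstoInDistribution_smearedSpin_of_seqBound
    (h₂ : normalizedField_variance_bounds) (hd : 4 ≤ d)
    {β δ ρ : ℕ → ℝ} (hβ : ∀ k, β k ∈ Set.Icc 0 (criticalBeta d))
    (hδ : Tendsto δ atTop (𝓝[>] (0 : ℝ)))
    {μ : ℕ → ProbabilityMeasure (SpinConfig (Site d))}
    (hμ : ∀ k, (μ k : Measure (SpinConfig (Site d))) ∈ isingGibbsMeasures d (β k) 0)
    {Ω : Type u} [MeasurableSpace Ω] {P : Measure Ω} [IsProbabilityMeasure P]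
    (Φ : TestFn d →ₗ[ℝ] Ω → ℝ)
    (hM2' : ∀ f : TestFn d, ∃ C : ℝ, ∀ k,
      ∫ σ, smearedSpin (ρ k) (δ k) f σ ^ 2 ∂(μ k : Measure (SpinConfig (Site d))) ≤ C)
    (hCV : ∀ f : TestFn d,
      TendstoInDistribution (fun k σ => smearedSpin (ρ k) (δ k) f σ) atTop (Φ f)
        (fun k => (μ k : Measure (SpinConfig (Site d)))) P)
    (hmgf : ∀ r : ℝ, 1 ≤ r → ∃ ε : ℕ → ℝ, (∀ k, 0 ≤ ε k) ∧ Tendsto ε atTop (𝓝 0) ∧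
      ∀ k, 0 < δ k → ∀ {f : EuclideanSpace ℝ (Fin d) → ℝ}, Continuous f →
        (∀ x, f x ≠ 0 → ∀ i, |x i| ≤ r) → ∀ z : ℝ,
        |(∫ σ, Real.exp (z * normalizedField (μ k : Measure (SpinConfig (Site d))) (δ k)⁻¹ f σ)
              ∂(μ k : Measure (SpinConfig (Site d)))) -
            Real.exp (z ^ 2 / 2 * ∫ σ, normalizedField (μ k : Measure (SpinConfig (Site d)))
              (δ k)⁻¹ f σ ^ 2 ∂(μ k : Measure (SpinConfig (Site d))))|
          ≤ Real.exp (z ^ 2 / 2 * ∫ σ, normalizedField (μ k : Measure (SpinConfig (Site d)))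
              (δ k)⁻¹ (fun x => |f x|) σ ^ 2 ∂(μ k : Measure (SpinConfig (Site d)))) *
              ((⨆ x, |f x|) ^ 4 * ε k * z ^ 4)) :
    IsGaussianProcess (fun f ω => Φ f ω) P := by
  obtain ⟨f₀, hf₀0, hf₀ne⟩ := exists_testFn_nonneg_ne_zero d
  obtain ⟨C₀, hC₀⟩ := hM2' f₀
  have hδpos : ∀ᶠ k in atTop, 0 < δ k := hδ.eventually (eventually_mem_nhdsWithin)
  -- Step A: every one-dimensional marginal `Φ g` is a centred Gaussian
  have h1d : ∀ g : TestFn d, ∃ v : ℝ≥0, P.map (Φ g) = gaussianReal 0 v := by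
    intro g
    obtain ⟨Cg, hCg⟩ := hM2' g
    obtain ⟨r, hr1, hgr⟩ := exists_cube_of_hasCompactSupport g g.hasCompactSupport
    have hcv := hCV g
    have hX : ∀ k, AEMeasurable (fun σ => smearedSpin (ρ k) (δ k) g σ)
        (μ k : Measure (SpinConfig (Site d))) := hcv.forall_aemeasurable
    have hΦg : AEMeasurable (Φ g) P := hcv.aemeasurable_limit
    haveI : IsProbabilityMeasure (P.map (Φ g)) := Measure.isProbabilityMeasure_map hΦg
    -- the exponential moments `M_k(z)`
    have hcore : ∀ z : ℝ, Tendsto (fun k =>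
        (∫ σ, Real.exp (z * smearedSpin (ρ k) (δ k) g σ) ∂(μ k : Measure (SpinConfig (Site d)))) *
          Real.exp (-(z ^ 2 * (∫ σ, smearedSpin (ρ k) (δ k) g σ ^ 2
            ∂(μ k : Measure (SpinConfig (Site d)))) / 2)) - 1) atTop (𝓝 0) := fun z =>
      tendsto_mgf_mul_exp_sub_one_of_seqBound h₂ hd hβ hδ
        (μ := fun k => (μ k : Measure (SpinConfig (Site d)))) hμ g.continuous
        g.hasCompactSupport f₀.continuous f₀.hasCompactSupport hf₀0 hf₀ne hC₀ hmgf z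
    -- uniform bound on `M_k(z)`: eventually `M_k(z) ≤ 2 exp(z² Cg/2)`
    have hbound : ∀ z : ℝ, ∀ᶠ k in atTop,
        (∫ σ, Real.exp (z * smearedSpin (ρ k) (δ k) g σ) ∂(μ k : Measure (SpinConfig (Site d))))
          ≤ 2 * Real.exp (z ^ 2 * Cg / 2) := by
      intro z
      have h := (hcore z)
      have h2 : ∀ᶠ k in atTop, (∫ σ, Real.exp (z * smearedSpin (ρ k) (δ k) g σ)
          ∂(μ k : Measure (SpinConfig (Site d)))) *
            Real.exp (-(z ^ 2 * (∫ σ, smearedSpin (ρ k) (δ k) g σ ^ 2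
              ∂(μ k : Measure (SpinConfig (Site d)))) / 2)) - 1 < 1 :=
        h.eventually (gt_mem_nhds one_pos)
      filter_upwards [h2] with k hk
      set V := ∫ σ, smearedSpin (ρ k) (δ k) g σ ^ 2 ∂(μ k : Measure (SpinConfig (Site d)))
      have hVle : V ≤ Cg := hCg k
      have hlt : (∫ σ, Real.exp (z * smearedSpin (ρ k) (δ k) g σ)
          ∂(μ k : Measure (SpinConfig (Site d)))) * Real.exp (-(z ^ 2 * V / 2)) < 2 := by
        linarith
      rw [Real.exp_neg, ← div_eq_mul_inv, div_lt_iff₀ (Real.exp_pos _)] at hlt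
      refine hlt.le.trans ?_
      gcongr
    -- laws and weak convergence
    let ν : ℕ → ProbabilityMeasure ℝ := fun k =>
      ⟨(μ k : Measure (SpinConfig (Site d))).map (fun σ => smearedSpin (ρ k) (δ k) g σ),
        Measure.isProbabilityMeasure_map (hX k)⟩
    let ν₀ : ProbabilityMeasure ℝ := ⟨P.map (Φ g), Measure.isProbabilityMeasure_map hΦg⟩
    have hν : Tendsto ν atTop (𝓝 ν₀) := hcv.tendsto
    -- convergence of `M_k(z)` to the (finite) exponential moment of the limit
    have hlimit : ∀ z : ℝ, Integrable (fun x => Real.exp (z * x)) (P.map (Φ g)) ∧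
        Tendsto (fun k => ∫ σ, Real.exp (z * smearedSpin (ρ k) (δ k) g σ)
          ∂(μ k : Measure (SpinConfig (Site d)))) atTop
          (𝓝 (∫ x, Real.exp (z * x) ∂(P.map (Φ g)))) := by
      intro z
      have hsq : ∀ x : ℝ, Real.exp (z * x) ^ 2 = Real.exp (2 * z * x) := fun x => by
        rw [sq, ← Real.exp_add]
        ring_nf
      have hB : ∀ᶠ k in atTop, Integrable (fun x => Real.exp (z * x) ^ 2) (ν k : Measure ℝ) ∧
          ∫ x, Real.exp (z * x) ^ 2 ∂(ν k : Measure ℝ) ≤ 2 * Real.exp ((2 * z) ^ 2 * Cg / 2) := by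
        filter_upwards [hbound (2 * z), hδpos] with k hk hδk
        have hmap : ∀ (F : ℝ → ℝ), Continuous F →
            ∫ x, F x ∂(ν k : Measure ℝ) = ∫ σ, F (smearedSpin (ρ k) (δ k) g σ)
              ∂(μ k : Measure (SpinConfig (Site d))) := fun F hF => by
          simp only [ν, ProbabilityMeasure.coe_mk]
          exact integral_map (hX k) hF.aestronglyMeasurable
        simp_rw [hsq]
        refine ⟨?_, ?_⟩
        · simp only [ν, ProbabilityMeasure.coe_mk]
          refine (integrable_map_measure (by fun_prop) (hX k)).mpr ?_
          exact integrable_exp_mul_smearedSpin _ (ρ k) hδk.ne' hgr (2 * z)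
        · rw [hmap _ (by fun_prop)]
          exact hk
      have h := tendsto_integral_of_tendsto_of_sq_le hν (by fun_prop)
        (fun x => (Real.exp_pos _).le) hB
      have hmap0 : ∀ k, ∫ x, Real.exp (z * x) ∂(ν k : Measure ℝ) =
          ∫ σ, Real.exp (z * smearedSpin (ρ k) (δ k) g σ)
            ∂(μ k : Measure (SpinConfig (Site d))) := fun k => by
        simp only [ν, ProbabilityMeasure.coe_mk]
        exact integral_map (hX k) (by fun_prop)
      refine ⟨h.1, ?_⟩
      have h2 := h.2
      simp_rw [hmap0] at h2
      exact h2
    -- identification of the limit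
    obtain ⟨v, hv0, hv⟩ := exists_variance_of_tendsto_mgf
      (Mlim := fun z => ∫ x, Real.exp (z * x) ∂(P.map (Φ g)))
      (Eventually.of_forall fun k => integral_nonneg fun σ => sq_nonneg _)
      hcore (fun z => (hlimit z).2)
    exact ⟨v.toNNReal, eq_gaussianReal_of_mgf_eq hv0 (fun z => (hlimit z).1) hv⟩
  -- Step B: linearity of `Φ` upgrades this to all finite-dimensional marginals
  refine ⟨fun I => ⟨isGaussian_of_map_eq_gaussianReal fun L => ?_⟩⟩
  have hmeas : AEMeasurable (fun ω => I.restrict fun f => Φ f ω) P :=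
    aemeasurable_pi_lambda _ fun f => (hCV f).aemeasurable_limit
  rw [AEMeasurable.map_map_of_aemeasurable (by fun_prop) hmeas]
  classical
  let g : TestFn d := ∑ i : I, (L fun j => if i = j then (1 : ℝ) else 0) • (i : TestFn d)
  have hcomp : ((L : (I → ℝ) → ℝ) ∘ fun ω => I.restrict fun f => Φ f ω) = Φ g := by
    funext ω
    rw [Function.comp_apply, ← ContinuousLinearMap.coe_coe,
      LinearMap.pi_apply_eq_sum_univ (L : (I → ℝ) →ₗ[ℝ] ℝ)]
    simp only [g, map_sum, map_smul, Finset.sum_apply, Pi.smul_apply, smul_eq_mul,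
      ContinuousLinearMap.coe_coe, Finset.restrict]
    exact Finset.sum_congr rfl fun i _ => mul_comm _ _
  obtain ⟨v, hv⟩ := h1d g
  exact ⟨0, v, by rw [hcomp, hv]⟩

universe u in
/-- **crit-ising.S13 in its original (`Sweep1`) form, from a one-state exponential-moment bound
and uniform smallness.** As `isGaussianProcess_of_tendstoInDistribution_smearedSpin_of_uniformlySmall`,
with the summed moment bound (ADC 2021 §6.3 third display / Aizenman CDM 2020 (7.9)) for the states
`μ ∈ 𝒢(β,0)`, `β ≤ β_c`, `d ≥ 4`, as the explicit hypothesis `hmgf`; granting moreover the variance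
bounds and the uniform smallness of `S(μ; L, r)` (hypothesis `hU`, proved in
`HighDimTrivialityUniformProofs`), every subsequential limit in law of the rescaled fields
with bounded second moments is a Gaussian process (renormalisation, exponential moments along
convergence in law, `complexMGF` uniqueness, linearity: `HighDimTriviality`, Part II). [cite: AizenmanDuminilCopinAnnals2021, arXiv:1912.07973 Thm 1.2 and p. 6 (the Gaussianity argument)] [cite: Panis2023Triviality, Thm. 1.2 and Cor. 1.8 (sub-sequential scaling limits are Gaussian)] -/
theorem isGaussianProcess_of_tendstoInDistribution_smearedSpin_of_mgfBound
    (hmgf : ∀ {d : ℕ}, 4 ≤ d → ∀ {β L r : ℝ}, 0 ≤ β → β ≤ criticalBeta d → 0 < L → 1 ≤ r →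
      ∀ {μ : Measure (SpinConfig (Site d))}, μ ∈ isingGibbsMeasures d β 0 →
      ∀ {f : EuclideanSpace ℝ (Fin d) → ℝ}, Continuous f → (∀ x, f x ≠ 0 → ∀ i, |x i| ≤ r) →
      ∀ z : ℝ,
        |(∫ σ, Real.exp (z * normalizedField μ L f σ) ∂μ) -
            Real.exp (z ^ 2 / 2 * ∫ σ, normalizedField μ L f σ ^ 2 ∂μ)|
          ≤ Real.exp (z ^ 2 / 2 * ∫ σ, normalizedField μ L (fun x => |f x|) σ ^ 2 ∂μ) *
              (24 * (⨆ x, |f x|) ^ 4 * ursellFourSum μ L r * z ^ 4))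
    (h₂ : normalizedField_variance_bounds)
    (hU : ∀ {d : ℕ}, 4 ≤ d → ∀ r : ℝ, 1 ≤ r → ∀ ε : ℝ, 0 < ε → ∃ L₀ : ℝ,
      ∀ (β L : ℝ), 0 ≤ β → β ≤ criticalBeta d → L₀ ≤ L →
      ∀ μ ∈ isingGibbsMeasures d β 0, ursellFourSum μ L r ≤ ε) :
    isGaussianProcess_of_tendstoInDistribution_smearedSpin.{u} := by
  intro d hd β δ ρ hβ hδ _hρ μ hμ Ω _ P _ Φ hM2' hCV
  exact isGaussianProcess_of_tendstoInDistribution_smearedSpin_of_seqBound h₂ hd hβ hδ hμ Φ hM2' hCV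
    fun r hr => ⟨fun k => 24 * ursellFourSum (μ k : Measure (SpinConfig (Site d))) (δ k)⁻¹ r,
      fun k => mul_nonneg (by norm_num) (ursellFourSum_nonneg _ _ _),
      by simpa using (tendsto_ursellFourSum_of_uniformlySmall hU hd hβ hδ hμ hr).const_mul 24,
      fun k hδk {_} hf hfr z =>
        (hmgf hd (hβ k).1 (hβ k).2 (inv_pos.2 hδk) hr (hμ k) hf hfr z).trans_eq (by ring)⟩

universe u in
/-- **crit-ising.S13 in its original (`Sweep1`) form, from the moment-level inputs and uniform
smallness.** For `d ≥ 4` and *arbitrary* `β_k ∈ [0, β_c]`, `δ_k → 0⁺`, `ρ_k > 0`,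
`μ_k ∈ 𝒢(β_k, 0)`: if the rescaled fields `Φ_k(f)` have bounded second moments and converge in
law for every test function `f` to `Φ(f)`, `Φ` a linear random functional, then `Φ` is a
Gaussian process — granting the smeared Aizenman inequality, Gaussian domination, the
vanishing of odd correlations, the variance bounds and the uniform smallness of `S(μ; L, r)`
(hypothesis `hU`, proved in `HighDimTrivialityUniformProofs`). The
probabilistic part is the argument of `HighDimTriviality`, Part II (renormalisation, exponential
moments along convergence in law, `complexMGF` uniqueness, linearity). [cite: AizenmanDuminilCopinAnnals2021, arXiv:1912.07973 Thm 1.2 and p. 6 (the Gaussianity argument)] [cite: Panis2023Triviality, Thm. 1.2 and Cor. 1.8 (sub-sequential scaling limits are Gaussian)] -/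
theorem isGaussianProcess_of_tendstoInDistribution_smearedSpin_of_uniformlySmall
    (hM1 : aizenman_evenMoment_deviation_le) (hM2 : newman_evenMoment_le)
    (hodd : oddSpinCorrelation_eq_zero) (h₂ : normalizedField_variance_bounds)
    (hU : ∀ {d : ℕ}, 4 ≤ d → ∀ r : ℝ, 1 ≤ r → ∀ ε : ℝ, 0 < ε → ∃ L₀ : ℝ,
      ∀ (β L : ℝ), 0 ≤ β → β ≤ criticalBeta d → L₀ ≤ L →
      ∀ μ ∈ isingGibbsMeasures d β 0, ursellFourSum μ L r ≤ ε) :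
    isGaussianProcess_of_tendstoInDistribution_smearedSpin.{u} :=
  isGaussianProcess_of_tendstoInDistribution_smearedSpin_of_mgfBound
    (fun {_} hd {_ _ _} hβ hβc hL hr {_} hμ {_} hf hfr z =>
      abs_mgf_normalizedField_sub_exp_le hM1 hM2 hodd (by omega) hβ hβc hL hr hμ hf hfr z)
    h₂ hU

universe u in
/-- **crit-ising.S13 (`isGaussianProcess_of_tendstoInDistribution_smearedSpin` of `Sweep1`, the
original statement with arbitrary `β_k ∈ [0, β_c]`) from the named facts of the literature**:
(i) the smeared Aizenman inequality `aizenman_evenMoment_deviation_le` and Gaussian domination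
`newman_evenMoment_le` (random-current input; reduced further in `HighDimTrivialityWick`),
(ii) Aizenman's tree diagram bound `aizenman_treeDiagramBound`, (iii) Panis 2023, Cor. 1.8
(`panis_ursellFourSum_le_four`, `d = 4`) and Thm 5.5 (`panis_ursellFourSum_le`, `d ≥ 5`),
(iv) the structure of `𝒢(β, 0)` up to `β_c`: uniqueness below and at `β_c`
(`hasUniqueGibbsMeasure_of_lt_criticalBeta`, `hasUniqueGibbsMeasure_criticalBeta`) and the free
state (`exists_freeMeasure`). The finite-volume flip symmetry, the modified Simon–Lieb
inequality, the GKS inequalities, the existence of box limits and the infrared bound that enter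
the proof are theorems of the tree. Eight named facts without proof remain in the trust base.
[cite: AizenmanDuminilCopinAnnals2021, arXiv:1912.07973 Thm 1.2, Prop. 1.4 and §6.3] [cite: Panis2023Triviality, Thm. 1.2, Cor. 1.8, Thm. 5.5 and §1.2.1 fn. 2] -/
theorem isGaussianProcess_of_tendstoInDistribution_smearedSpin_of_facts
    (hM₁ : aizenman_evenMoment_deviation_le) (hM₂ : newman_evenMoment_le)
    (hT : aizenman_treeDiagramBound) (hP₄ : panis_ursellFourSum_le_four)
    (hP₅ : panis_ursellFourSum_le)
    (hU₁ : ∀ {d : ℕ} {β : ℝ}, hasUniqueGibbsMeasure_of_lt_criticalBeta (d := d) (β := β))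
    (hU₂ : ∀ {d : ℕ}, hasUniqueGibbsMeasure_criticalBeta (d := d))
    (hF : ∀ (d : ℕ) {β : ℝ}, exists_freeMeasure d (β := β) 0) :
    isGaussianProcess_of_tendstoInDistribution_smearedSpin.{u} :=
  isGaussianProcess_of_tendstoInDistribution_smearedSpin_of_uniformlySmall hM₁ hM₂
    (oddSpinCorrelation_eq_zero_of_facts hU₁ hU₂ hF fun d => isingCorr_free_of_odd_card_holds (zdGraph d))
    (normalizedField_variance_bounds_of_facts hU₁ hU₂ hF)
    (ursellFourSum_uniformlySmall_of_facts hT hP₄ hP₅ hU₁ hU₂ hF)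

end Literature.Probability.LatticeModels
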